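import Mathlib

/-!
# Weight elements and degree-one loop surgery on `F × S¹`

Group-theoretic core of the admissibility criterion used by the soloist programme
(solo-SmoothPoincare4-informed, session 32, `work/s32/structureII.md` §11.1 (iii)):
for an integral homology 3-sphere `F` (so `π₁ F` is perfect) and a loop `Γ_g ⊂ F × S¹`
that is the graph of a based loop `g`, the surgered 4-manifold has fundamental group
`(π₁F × ℤ) / ⟪(g, t)⟫`, and this is trivial iff `g` is a weight element of `π₁ F`.

We prove the purely algebraic statement: for a perfect group `P` and `g : P`, the normal
closure of `(g, t)` in `P × ℤ` (`t` a generator) is everything iff the normal closure of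
`g` in `P` is everything.  No topology is formalised here.
-/

namespace Summit.SmoothPoincare4.SmoothPoincare4.Theorems

open Subgroup

/-- Projection half (no perfectness needed): if `⟪(g,t)⟫ = P × ℤ` then `⟪g⟫ = P`. -/
theorem SoloInformed_normalClosure_eq_top_of_prod
    {P : Type*} [Group P] (g : P)
    (h : normalClosure ({(g, Multiplicative.ofAdd (1:ℤ))} : Set (P × Multiplicative ℤ)) = ⊤) :
    normalClosure ({g} : Set P) = ⊤ := by
  have hsurj : Function.Surjective (MonoidHom.fst P (Multiplicative ℤ)) :=
    fun p => ⟨(p, 1), rfl⟩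
  have h1 := Subgroup.map_normalClosure
    ({(g, Multiplicative.ofAdd (1:ℤ))} : Set (P × Multiplicative ℤ))
    (MonoidHom.fst P (Multiplicative ℤ)) hsurj
  rw [h, Subgroup.map_top_of_surjective _ hsurj] at h1
  have h2 : ((MonoidHom.fst P (Multiplicative ℤ)) ''
      ({(g, Multiplicative.ofAdd (1:ℤ))} : Set (P × Multiplicative ℤ)) : Set P) = {g} := by
    simp [Set.image_singleton]
  rw [h2] at h1
  exact h1.symm

/-- Perfect half: if `P` is perfect and `g` is a weight element of `P`, then `(g,t)` is a
weight element of `P × ℤ`. -/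
theorem SoloInformed_normalClosure_prod_eq_top_of_perfect
    {P : Type*} [Group P] (hP : commutator P = ⊤) (g : P)
    (h : normalClosure ({g} : Set P) = ⊤) :
    normalClosure ({(g, Multiplicative.ofAdd (1:ℤ))} : Set (P × Multiplicative ℤ)) = ⊤ := by
  -- the quotient by the normal closure and the two structure maps
  haveI hN : (normalClosure ({(g, Multiplicative.ofAdd (1:ℤ))} :
      Set (P × Multiplicative ℤ))).Normal := Subgroup.normalClosure_normal
  let π : P × Multiplicative ℤ →*
      (P × Multiplicative ℤ) ⧸ normalClosure ({(g, Multiplicative.ofAdd (1:ℤ))} :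
        Set (P × Multiplicative ℤ)) :=
    QuotientGroup.mk' _
  let ψ : P →* _ := π.comp (MonoidHom.inl P (Multiplicative ℤ))
  let θ : Multiplicative ℤ →* _ := π.comp (MonoidHom.inr P (Multiplicative ℤ))
  have hπ_surj : Function.Surjective π := QuotientGroup.mk'_surjective _
  -- π kills (g,t)
  have hgt : π (g, Multiplicative.ofAdd (1:ℤ)) = 1 :=
    (QuotientGroup.eq_one_iff _).mpr (Subgroup.subset_normalClosure (Set.mem_singleton _))
  -- decomposition (g,t) = (g,1) * (1,t)
  have hdecomp : ((g, Multiplicative.ofAdd (1:ℤ)) : P × Multiplicative ℤ)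
      = (MonoidHom.inl P (Multiplicative ℤ)) g *
        (MonoidHom.inr P (Multiplicative ℤ)) (Multiplicative.ofAdd (1:ℤ)) := by
    simp
  have hψθ : ψ g * θ (Multiplicative.ofAdd (1:ℤ)) = 1 := by
    show π _ * π _ = 1
    rw [← map_mul, ← hdecomp, hgt]
  have hθ : θ (Multiplicative.ofAdd (1:ℤ)) = (ψ g)⁻¹ :=
    eq_inv_of_mul_eq_one_right hψθ
  -- θ t is central (image of a central element under a surjection), hence so is ψ g
  have hcent_t : ∀ q, Commute (θ (Multiplicative.ofAdd (1:ℤ))) q := by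
    intro q
    obtain ⟨x, rfl⟩ := hπ_surj q
    show π _ * π x = π x * π _
    rw [← map_mul, ← map_mul]
    congr 1
    ext <;> simp [mul_comm]
  have hcent_g : ∀ q, Commute (ψ g) q := by
    intro q
    have := (hcent_t q).inv_left
    rw [hθ, inv_inv] at this
    exact this
  -- every ψ p lies in the cyclic central subgroup generated by ψ g
  have key : ∀ p : P, ψ p ∈ Subgroup.zpowers (ψ g) := by
    have hSnormal : ((Subgroup.zpowers (ψ g)).comap ψ).Normal := by
      constructor
      intro n hn x
      rw [Subgroup.mem_comap] at hn ⊢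
      obtain ⟨k, hk⟩ := Subgroup.mem_zpowers_iff.mp hn
      rw [map_mul, map_mul, map_inv, ← hk]
      have hc : Commute ((ψ g) ^ k) (ψ x) := (hcent_g (ψ x)).zpow_left k
      rw [← hc.eq, mul_inv_cancel_right]
      exact Subgroup.mem_zpowers_iff.mpr ⟨k, rfl⟩
    have hle : normalClosure ({g} : Set P) ≤ (Subgroup.zpowers (ψ g)).comap ψ := by
      apply Subgroup.normalClosure_le_normal
      intro x hx
      rw [Set.mem_singleton_iff] at hx
      subst hx
      rw [SetLike.mem_coe, Subgroup.mem_comap]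
      exact Subgroup.mem_zpowers _
    intro p
    have hp : p ∈ (Subgroup.zpowers (ψ g)).comap ψ := by
      rw [h] at hle
      exact hle (Subgroup.mem_top p)
    rwa [Subgroup.mem_comap] at hp
  -- hence ψ kills commutators, so ψ is trivial (P perfect)
  have hψ_triv : ∀ p : P, ψ p = 1 := by
    have hker : commutator P ≤ ψ.ker := by
      rw [_root_.commutator_def, Subgroup.commutator_le]
      intro a _ b _
      rw [MonoidHom.mem_ker, map_commutatorElement, commutatorElement_eq_one_iff_mul_comm]
      obtain ⟨i, hi⟩ := Subgroup.mem_zpowers_iff.mp (key a)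
      obtain ⟨j, hj⟩ := Subgroup.mem_zpowers_iff.mp (key b)
      rw [← hi, ← hj]
      exact zpow_mul_comm _ _ _
    intro p
    have : p ∈ ψ.ker := by
      rw [hP] at hker
      exact hker (Subgroup.mem_top p)
    rwa [MonoidHom.mem_ker] at this
  -- and θ is trivial because it kills the generator
  have hθ_triv : θ = 1 := by
    apply MonoidHom.ext_mint
    rw [hθ, hψ_triv g, inv_one, MonoidHom.one_apply]
  -- conclude: π is trivial, so the normal closure is everything
  rw [eq_top_iff]
  intro x _
  rw [← QuotientGroup.eq_one_iff]
  show π x = 1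
  have hx : x = (MonoidHom.inl P (Multiplicative ℤ)) x.1 *
      (MonoidHom.inr P (Multiplicative ℤ)) x.2 := by
    ext <;> simp
  rw [hx, map_mul]
  show ψ x.1 * θ x.2 = 1
  rw [hψ_triv, hθ_triv, MonoidHom.one_apply, one_mul]

/-- The criterion: for a perfect group `P` (e.g. `π₁` of an integral homology 3-sphere) and
`g : P`, `(g, t)` normally generates `P × ℤ` iff `g` normally generates `P`. -/
theorem SoloInformed_weightElement_prod_int_iff
    {P : Type*} [Group P] (hP : commutator P = ⊤) (g : P) :
    normalClosure ({(g, Multiplicative.ofAdd (1:ℤ))} : Set (P × Multiplicative ℤ)) = ⊤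
      ↔ normalClosure ({g} : Set P) = ⊤ :=
  ⟨SoloInformed_normalClosure_eq_top_of_prod g,
   SoloInformed_normalClosure_prod_eq_top_of_perfect hP g⟩

/-- Perfectness is needed: for `P = ℤ` (not perfect) and `g = 1 ∈ ℤ` a generator, `g`
normally generates `P` but `(g, t)` does not normally generate `P × ℤ` (the quotient is `ℤ`).
We record the positive half of this remark: `g` normally generates. -/
theorem SoloInformed_weightElement_int_example :
    normalClosure ({Multiplicative.ofAdd (1:ℤ)} : Set (Multiplicative ℤ)) = ⊤ := by
  rw [eq_top_iff]
  intro x _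
  have hx : x = (Multiplicative.ofAdd (1:ℤ)) ^ (Multiplicative.toAdd x) := by
    rw [← ofAdd_zsmul, smul_eq_mul, mul_one, ofAdd_toAdd]
  rw [hx]
  exact Subgroup.zpow_mem _ (Subgroup.subset_normalClosure (Set.mem_singleton _)) _

end Summit.SmoothPoincare4.SmoothPoincare4.Theorems
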